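import Literature.NumberTheory.LFunctions.Zhang2022.KnifeEdgeEq148DUniform

/-!
# §D edge ell — card `prime-discharge-thin-bdh`: the faithful-range (14.8) estimate E-016′, the ℓ-side variance
# `ThinBDH`, and the card's bridge K2 (statements only)

Y. Zhang, *Discrete mean estimates and the Landau–Siegel zero*, arXiv:2211.02515v1 [Zhang2022LandauSiegel] — an
unrefereed manuscript under adjudication. **WHAT THIS IS NOT: not a claim about Theorems 1–2 of arXiv:2211.02515,
about Landau–Siegel zeros, about Parity, or about a repaired `Margin232`. Every `Prop` below (`Eq148DUniformFaithful`,
`Eq148DUniformFaithfulUncond`, `ThinBDHAt`, `ThinBDH`, `FaithfulBoundFor`, `ThinBDHBridge`) is a DEFINITION asserted by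
no one: E-016′ is open-in-print (XL on `B ∈ (¼, ½]`), `ThinBDH` is the card's HYPOTHESIS ON a coefficient family, the
bridge is the card's crux K2. The programme SEARCHES and TYPES; no claim about Landau–Siegel zeros, Theorems 1–2 of
arXiv:2211.02515 or a repaired Margin232 until a kernel theorem says so.** (LANDAU–SIEGEL programme F-S3, cell
`landau-siegel`, §D edge ell = E*-ℓ⁺; crux idea card `prime-discharge-thin-bdh`, ls-knife-ell-idea-1 g2, ledger
`Parity/GeneralizedHardyLittlewood`, commit 778cb19b7865, filed 2026-08-27T02:33:16Z; typer ls-knife-typer-2 g4.)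

## What is typed

* Part A — **E-016′, the live form of registry row E-016** (cell file `theory/ELL-CENSUS.md` v1.1/v1.2 item (4), verbatim:
  «E-016 `KnifeEdge.Eq148DUniform` types the print-literal h-range `h < P/r` (Zhang's relaxation of `hr = Dk < 2DP₄`,
  faithful iff `2DP₄ ≤ P ⟺ T² ≥ 2Dt₀`) and the print-literal target ⇒ TRUNCATED … ; E-016′ := faithful range
  `h ∈ [1, ⌈2DP₄/r⌉)` with target `C·P²·D^{1/2−c}` is the live object (open-in-print, XL on (¼, ½])»). Typed WITHOUT
  restating §14: `u017MajorantAt χ S κs R H` is the u017 majorant of `KnifeEdgeEq148DUniform` with the `h`-cutoff a free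
  function `H` (`rhs1417OnAt_eq_u017MajorantAt : rhs1417OnAt = u017MajorantAt … (r ↦ ⌈P/r⌉)` by `rfl`);
  `faithfulCutoff S D r = ⌈2D·P₄/r⌉`; `rhs148FaithfulAt := u017MajorantAt … (faithfulCutoff S D)`; the estimates
  `Eq148DUniformFaithful A B` (⟨A⟩-guarded, design-facing) / `Eq148DUniformFaithfulUncond A B` (priced) with target
  `C·P²·D^{1/2−c}`; bookkeeping `u017MajorantAt_nonneg/_mono_range/_mono_cutoff`, `rhs1417OnAt_le_rhs148FaithfulAt`
  (truncated ≤ faithful once `P ≤ 2DP₄`), `eq148DUniformFaithful_of_uncond`.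
* Part B — **the card's objects** (the ideator's typed sketch `knife/ell/idea-1/ThinBDHSketch.lean` sha16 19578b24cbedb59b,
  bodies verbatim): `lSumAdd` (the twisted, Mellin-separated `ℓ`-sum against `e(aℓ/m)`), `thinVarianceAdd` (additive
  reduced-residue variance over all moduli `m ∈ (M, 2M]` coprime to `D`, summed over a finite set of twists mod `D`),
  `M0 S D c = P·D^{−1−2c}·t₀^{−2}` (the large-sieve threshold modulus), **`ThinBDHAt A B c κ`** (the card's hypothesis ON the
  coefficient family `κ : D ↦ κ_D` with the saving exponent `c` displayed) and `ThinBDH A B κ := ∃ c > 0, ThinBDHAt A B c κ`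
  (the sketch's `LsKnifeEllIdea1.ThinBDH`, same binders).
* Part C — **the card's crux K2 as a `Prop`**: `FaithfulBoundFor A B κ` (E-016′'s conclusion for ONE coefficient family,
  no ⟨A⟩ guard — the bridge is harmonic analysis) and `ThinBDHBridge A B := ∀ κ c, 0 < c → ¼ + c < B → B < ½ →
  ThinBDHAt A B c κ → FaithfulBoundFor A B κ` (card, «What it needs» K2: «∀κ: ThinBDH(A,B;κ) ∧ Eq141(κ) ∧ Eq142(a*) ⇒
  faithful (14.8)-majorant(κ) ≤ C·P²·D^{1/2−c′} for B ∈ (1/4+c,1/2)»; (14.1)/(14.2) sit inside `FaithfulBoundFor`).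
  `faithfulBoundFor_all_of_uncond`: the priced ∀κ form gives the conclusion for every family (so the bridge's content is the
  passage from a hypothesis ON `κ` to the bound for THAT `κ`).
* Part D — **non-vacuity bookkeeping** (the card's cheapest falsifier (b) «the M-range `[M₀, 2P₄]` is nonempty; the right
  side beats the large-sieve size `N²` by `M₀/M ≤ D^{2B−1−2c}/2` at the top»): `M0_pos`, the exact ratio
  `M0_div_two_mul_P4` (`M₀/(2P₄) = D^{2B−1−2c}/(2t₀³)` at `scalesAt A B D`) and `M0_le_two_mul_P4` (`B ≤ ½ + c`, `D ≥ 3` ⇒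
  `M₀ ≤ 2P₄`).

Deliberately NOT here: any proof or refutation of E-016/E-016′ (the card's P2 «¬`Eq148DUniformUncond A B` for every
`A > 0`, `B < ½`» is a refuter target, HOME/ls-knife-ell-idea-1/NOTES-g2.md BN-ℓ8); the bridge's proof (crux K2); the
structure audit K3 of `b`; Zhang's `κ* = κ₁∗b` as a concrete family (the card's thesis `ThinBDH(A,B;κ*)` is `ThinBDH A B κ`
at that family, to be supplied by the route).
References: Zhang, arXiv:2211.02515v1, §14 (14.1)–(14.2), (14.5)–(14.8) pp.76–79 (tex L3828–L3964), §15 (15.1)–(15.2);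
Montgomery–Vaughan, *Multiplicative Number Theory I*, ch. 7 pp.226–227 (large sieve; its optimality).
[cite: Zhang2022LandauSiegel, §14 (14.8) p.79]
-/

noncomputable section

open Complex Real

namespace Literature.NumberTheory.LFunctions.Zhang2022

namespace KnifeEdge

open Skeleton EllScales Typed.Sec14

/-! ## Part A — E-016′: the u017 majorant with a free `h`-cutoff, the faithful range, the target `P²D^{1/2−c}` -/

variable {D : ℕ} [NeZero D] (χ : DirichletCharacter ℂ D)

/-- **The u017 majorant of the left side of (14.8) at free scales with a FREE `h`-cutoff `H`**: the summation structure
of `KnifeEdge.rhs1417OnAt` verbatim (`d ≤ 2P₄` with weight `d⁻¹`; `r ∈ R`; `h ∈ [1, H r)`, `h ≡ 0 (mod D/(D,r))`; weight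
`D/(φ(hr)h√r)`; primitive `θ (mod r)` with `χθ̄` non-principal; `|Σ_{(l,h)=1} κ*(dl)θ(l) Σ_{p∼P} χθ̄(p)Δ(l/(phr))|`), the
print-literal cutoff being `H r = ⌈P/r⌉` (`rhs1417OnAt_eq_u017MajorantAt`). [cite: Zhang2022LandauSiegel, §14 u017 p.79, tex L3956] -/
def u017MajorantAt (S : Scales) (κs : ℕ → ℂ) (R : Finset ℕ) (H : ℕ → ℕ) : ℝ :=
  ∑ d ∈ Finset.Icc 1 ⌊2 * S.P4⌋₊, (d : ℝ)⁻¹ * ∑ r ∈ R,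
    ∑ h ∈ (Finset.Ico 1 (H r)).filter (fun h => D / Nat.gcd D r ∣ h),
      (D : ℝ) / ((Nat.totient (h * r) : ℝ) * h * Real.sqrt r) *
        ∑ θ ∈ finsetOf {θ : DirichletCharacter ℂ r | θ.IsPrimitive ∧
            DirichletCharacter.changeLevel (dvd_mul_left r D) θ ≠
              DirichletCharacter.changeLevel (dvd_mul_right D r) χ},
          ‖∑' l : ℕ, if Nat.Coprime l h then
              κs (d * l) * θ (l : ZMod r) *
                ∑ p ∈ S.primeWindow, χ (p : ZMod D) * θ⁻¹ (p : ZMod r) *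
                  DeltaAt S ((l : ℝ) / ((p : ℝ) * h * r)) else 0‖

omit [NeZero D] in
/-- **Regression (nothing of E-016 is restated):** the registry's majorant `rhs1417OnAt` IS `u017MajorantAt` at the
print-literal cutoff `h < ⌈P/r⌉`. [cite: Zhang2022LandauSiegel, §14 u017 p.79, tex L3956] -/
theorem rhs1417OnAt_eq_u017MajorantAt (S : Scales) (κs : ℕ → ℂ) (R : Finset ℕ) :
    rhs1417OnAt χ S κs R = u017MajorantAt χ S κs R (fun r => ⌈S.P / r⌉₊) := rfl

omit [NeZero D] χ in
/-- **The FAITHFUL `h`-cutoff** `⌈2D·P₄/r⌉`: the moduli of (14.6) are `hr = Dk` with `k < 2P₄`, i.e. `hr < 2DP₄`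
(ELL-CENSUS v1.1 item (4): Zhang's `h < P/r` is a relaxation, faithful iff `2DP₄ ≤ P ⟺ T² ≥ 2Dt₀`).
[cite: Zhang2022LandauSiegel, §14 (14.6)–(14.8) p.79, tex L3945–L3963] -/
def faithfulCutoff (S : Scales) (D : ℕ) (r : ℕ) : ℕ := ⌈2 * (D : ℝ) * S.P4 / r⌉₊

omit [NeZero D] in
/-- **The faithful-range u017 majorant of (14.8)** (`h ∈ [1, ⌈2DP₄/r⌉)`): the left object of E-016′.
[cite: Zhang2022LandauSiegel, §14 (14.8) p.79, tex L3945–L3963] -/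
def rhs148FaithfulAt (S : Scales) (κs : ℕ → ℂ) (R : Finset ℕ) : ℝ :=
  u017MajorantAt χ S κs R (faithfulCutoff S D)

omit [NeZero D] in
/-- Every term of the free-cutoff majorant is non-negative. [cite: Zhang2022LandauSiegel, §14 u017 p.79] -/
theorem u017MajorantAt_nonneg (S : Scales) (κs : ℕ → ℂ) (R : Finset ℕ) (H : ℕ → ℕ) :
    0 ≤ u017MajorantAt χ S κs R H := by
  unfold u017MajorantAt
  refine Finset.sum_nonneg fun d _ => mul_nonneg (inv_nonneg.mpr (Nat.cast_nonneg d)) ?_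
  refine Finset.sum_nonneg fun r _ => Finset.sum_nonneg fun h _ => mul_nonneg ?_ ?_
  · exact div_nonneg (Nat.cast_nonneg D)
      (mul_nonneg (mul_nonneg (Nat.cast_nonneg _) (Nat.cast_nonneg h)) (Real.sqrt_nonneg r))
  · exact Finset.sum_nonneg fun θ _ => norm_nonneg _

omit [NeZero D] in
/-- The free-cutoff majorant is monotone in the `r`-range. [cite: Zhang2022LandauSiegel, §14 u017 p.79] -/
theorem u017MajorantAt_mono_range (S : Scales) (κs : ℕ → ℂ) {R R' : Finset ℕ} (hR : R ⊆ R') (H : ℕ → ℕ) :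
    u017MajorantAt χ S κs R H ≤ u017MajorantAt χ S κs R' H := by
  unfold u017MajorantAt
  refine Finset.sum_le_sum fun d _ => mul_le_mul_of_nonneg_left ?_ (inv_nonneg.mpr (Nat.cast_nonneg d))
  refine Finset.sum_le_sum_of_subset_of_nonneg hR fun r _ _ => ?_
  refine Finset.sum_nonneg fun h' _ => mul_nonneg ?_ ?_
  · exact div_nonneg (Nat.cast_nonneg D)
      (mul_nonneg (mul_nonneg (Nat.cast_nonneg _) (Nat.cast_nonneg h')) (Real.sqrt_nonneg r))
  · exact Finset.sum_nonneg fun θ _ => norm_nonneg _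

omit [NeZero D] in
/-- **The free-cutoff majorant is monotone in the cutoff**: enlarging every `H r` (`r ∈ R`) can only increase it.
[cite: Zhang2022LandauSiegel, §14 u017 p.79] -/
theorem u017MajorantAt_mono_cutoff (S : Scales) (κs : ℕ → ℂ) (R : Finset ℕ) {H H' : ℕ → ℕ}
    (hH : ∀ r ∈ R, H r ≤ H' r) : u017MajorantAt χ S κs R H ≤ u017MajorantAt χ S κs R H' := by
  unfold u017MajorantAt
  refine Finset.sum_le_sum fun d _ => mul_le_mul_of_nonneg_left ?_ (inv_nonneg.mpr (Nat.cast_nonneg d))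
  refine Finset.sum_le_sum fun r hr => ?_
  refine Finset.sum_le_sum_of_subset_of_nonneg ?_ fun h' _ _ => ?_
  · exact Finset.filter_subset_filter _ (Finset.Ico_subset_Ico_right (hH r hr))
  · refine mul_nonneg ?_ ?_
    · exact div_nonneg (Nat.cast_nonneg D)
        (mul_nonneg (mul_nonneg (Nat.cast_nonneg _) (Nat.cast_nonneg h')) (Real.sqrt_nonneg r))
    · exact Finset.sum_nonneg fun θ _ => norm_nonneg _

omit [NeZero D] in
/-- **Truncated ≤ faithful once `P ≤ 2DP₄`** (i.e. `T² ≤ 2Dt₀`, the `B ≤ ½` side of the knife edge): the registry's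
majorant `rhs1417OnAt` is bounded by the faithful one `rhs148FaithfulAt` (so an E-016′-type bound implies the E-016-type
bound with the same right side there). [cite: Zhang2022LandauSiegel, §14 (14.8) p.79, tex L3945–L3963] -/
theorem rhs1417OnAt_le_rhs148FaithfulAt (S : Scales) (κs : ℕ → ℂ) (R : Finset ℕ) (hP : S.P ≤ 2 * (D : ℝ) * S.P4) :
    rhs1417OnAt χ S κs R ≤ rhs148FaithfulAt χ S κs R := by
  rw [rhs1417OnAt_eq_u017MajorantAt]
  refine u017MajorantAt_mono_cutoff χ S κs R fun r _ => ?_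
  unfold faithfulCutoff
  exact Nat.ceil_le_ceil (div_le_div_of_nonneg_right hP (Nat.cast_nonneg r))

/-- **E-016′ `Eq148DUniformFaithful A B` — the LIVE form of the needed estimate (a hypothesis `Prop`; open-in-print, XL on
`B ∈ (¼, ½]`; asserted by no one; ELL-CENSUS v1.1 item (4)).** At the scales `P = D^A`, `T = D^B` (the other scales as
printed): for every implied constant `Bτ` of (14.1)–(14.2) there are `c > 0` and `C` such that, for all sufficiently large
`D`, every real primitive `χ (mod D)` satisfying (A), and all sequences `𝐤*`, `𝐚*` with (14.1)/(14.2), the u017 majorant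
of (14.8) on the large-conductor range `D³ ≤ r < 2DP₄` with the FAITHFUL `h`-range `h < 2DP₄/r` is
`≤ C·P²·D^{1/2−c}` — the target Prop 14.1 actually consumes ((14.5)/(14.6): the non-principal `θ` enter through
`τ(χ)χ(p)/D`, `|τ(χ)/D| = D^{−1/2}`). Same binders as `Eq148DUniform`; two changes: cutoff and tolerance.
[cite: Zhang2022LandauSiegel, §14 (14.5)–(14.8) pp.78–79, tex L3896–L3963] -/
def Eq148DUniformFaithful (A B : ℝ) : Prop :=
  ∀ Bτ : ℝ, ∃ c : ℝ, 0 < c ∧ ∃ C : ℝ, ForAllLarge fun D _ χ => AssumptionA D χ →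
    ∀ κs as : ℕ → ℂ, Eq141 Bτ κs → Eq142At (scalesAt A B D) Bτ as →
      rhs148FaithfulAt χ (scalesAt A B D) κs (largeConductorRange (scalesAt A B D) D)
        ≤ C * (scalesAt A B D).P ^ 2 * (D : ℝ) ^ (1 / 2 - c)

/-- **`Eq148DUniformFaithfulUncond A B` — the PRICED form of E-016′** (no ⟨A⟩ guard; `χ` stays a binder because it
enters the majorant through `χθ̄(p)`). The card's refutation rung P2 / barrier note BN-ℓ8 targets the `∀κ` forms
(`Eq148DUniformUncond`, and this one for `B < 1/3 + c/3`); nothing here asserts or refutes it.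
[cite: Zhang2022LandauSiegel, §14 (14.5)–(14.8) pp.78–79, tex L3896–L3963] -/
def Eq148DUniformFaithfulUncond (A B : ℝ) : Prop :=
  ∀ Bτ : ℝ, ∃ c : ℝ, 0 < c ∧ ∃ C : ℝ, ForAllLarge fun D _ χ =>
    ∀ κs as : ℕ → ℂ, Eq141 Bτ κs → Eq142At (scalesAt A B D) Bτ as →
      rhs148FaithfulAt χ (scalesAt A B D) κs (largeConductorRange (scalesAt A B D) D)
        ≤ C * (scalesAt A B D).P ^ 2 * (D : ℝ) ^ (1 / 2 - c)

/-- The priced form implies the design-facing (⟨A⟩-guarded) one. [cite: Zhang2022LandauSiegel, §14 (14.8) p.79] -/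
theorem eq148DUniformFaithful_of_uncond {A B : ℝ} (h : Eq148DUniformFaithfulUncond A B) :
    Eq148DUniformFaithful A B := by
  intro Bτ
  obtain ⟨c, hc, C, D₀, hD₀⟩ := h Bτ
  exact ⟨c, hc, C, D₀, fun D _ χ hD hq hp _ κs as h1 h2 => hD₀ D χ hD hq hp κs as h1 h2⟩

end KnifeEdge

namespace KnifeEdgeEll.PrimeDischarge

open KnifeEdge EllScales Skeleton Typed.Sec14
open scoped BigOperators

/-! ## Part B — the card's objects (ideator's sketch `ThinBDHSketch.lean` sha16 19578b24cbedb59b, bodies verbatim) -/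

/-- **The twisted, Mellin-separated `ℓ`-sum** over the dyadic window `(N, 2N]` against the additive character `e(aℓ/m)`:
`S_{d,θ_D,τ}(a/m) = Σ_{N<ℓ≤2N} κ(dℓ)θ_D(ℓ)ℓ^{iτ}e(aℓ/m)` (sharp window as a stand-in for Zhang's smooth `Δ`).
[cite: Zhang2022LandauSiegel, §14 (14.6)–(14.8) p.79] -/
def lSumAdd (κ : ℕ → ℂ) (d : ℕ) {D : ℕ} (θD : DirichletCharacter ℂ D) (τ Nlen : ℝ) (m a : ℕ) : ℂ :=
  ∑ l ∈ Finset.Ioc ⌊Nlen⌋₊ ⌊2 * Nlen⌋₊,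
    κ (d * l) * θD (l : ZMod D) * ((l : ℂ) ^ ((τ : ℂ) * Complex.I)) *
      Complex.exp (2 * Real.pi * Complex.I * ((a : ℂ) * (l : ℂ) / (m : ℂ)))

/-- **Additive reduced-residue variance** of `ℓ ↦ κ(dℓ)θ_D(ℓ)ℓ^{iτ}` over ALL moduli `m ∈ (M, 2M]` coprime to `D`,
summed over a finite set of twists `θ_D (mod D)`: `Σ_{θ_D} Σ_{m∼M,(m,D)=1} Σ*_{a mod m} |S_{d,θ_D,τ}(a/m)|²` (the
multiplicative primitive form `Σ_m (m/φ(m)) Σ*_{ψ mod m} |…|²` is bounded by it, Gallagher).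
[cite: Zhang2022LandauSiegel, §14 (14.6)–(14.8) p.79] -/
def thinVarianceAdd (κ : ℕ → ℂ) (d D : ℕ) (twists : Finset (DirichletCharacter ℂ D)) (τ Nlen : ℝ) (M : ℕ) : ℝ :=
  ∑ θD ∈ twists, ∑ m ∈ (Finset.Ioc M (2 * M)).filter (fun m => Nat.Coprime m D),
    ∑ a ∈ (Finset.range m).filter (fun a => Nat.Coprime a m),
      ‖lSumAdd κ d θD τ Nlen m a‖ ^ 2

/-- **The large-sieve threshold modulus `M₀ = P·D^{−1−2c}·t₀^{−2}`** of the binding range: the modulus at which the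
large sieve alone meets the tolerance `P²D^{1/2−c}`. [cite: Zhang2022LandauSiegel, §14 (14.8) p.79] -/
def M0 (S : Scales) (D : ℕ) (c : ℝ) : ℝ :=
  S.P * (D : ℝ) ^ (-1 - 2 * c) * (S.t0 ^ 2)⁻¹

/-- **`ThinBDHAt A B c κ` — the card's HYPOTHESIS ON the coefficient family `κ : D ↦ κ_D`, saving exponent `c` displayed
(OPEN; asserted by no one; the ideator's placement: GRH-true for `D ≥ D₀(A,B,c)`, unconditionally of q-aspect
density-hypothesis strength, FALSE for general divisor-bounded families — BN-ℓ8).** ERRATUM (v3, critic ls-knife-crit-2 g4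
F-ℓ13 2026-08-27T03:16:36Z, custodian ls-theory g2 03:22:06Z (3)): this family (twists mod `D` × `a/m`, `(m, D) = 1`) is
TOO THIN for `largeConductorRange` — it misses the primitive conductors `p·D·r″`, `p ∣ D` (conductor `p`-part
`p^{v_p(D)+1}`); the hypothesis OF RECORD is `ThinBDHAllAt` (`KnifeEdgeEllThinBDHAll`, all moduli `D·m`, conductors
`r ∣ D·m`, `r ≥ D³`). This `def` is kept (landed, cited) as the card's sketch verbatim. At Zhang's free scales `P = D^A`,
`T = D^B`: there are `C, C′, D₀` such that for all `D ≥ D₀`, every finite set of twists mod `D`, every `1 ≤ d ≤ 2P₄`, every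
`|τ| ≤ (log D)^600` and every modulus range `M ∈ [M₀, 2P₄]`, with `N = D·M·P·t₀`, the additive primitive variance is at
most `C·N²·(M₀/M)·(log D)^{C′}` — the large-sieve(=trivial) size `N²` improved by the factor `M₀/M`
(up to `D^{1−2B+2c}` at the top `M = 2P₄`). [cite: Zhang2022LandauSiegel, §14 (14.6)–(14.8) p.79; §15 (15.1)–(15.2)] -/
def ThinBDHAt (A B c : ℝ) (κ : ℕ → ℕ → ℂ) : Prop :=
  ∃ C C' : ℝ, ∃ D₀ : ℕ, ∀ D : ℕ, D₀ ≤ D →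
    ∀ twists : Finset (DirichletCharacter ℂ D),
    ∀ d : ℕ, 1 ≤ d → (d : ℝ) ≤ 2 * (scalesAt A B D).P4 →
    ∀ τ : ℝ, |τ| ≤ Real.log D ^ (600 : ℕ) →
    ∀ M : ℕ, M0 (scalesAt A B D) D c ≤ M → (M : ℝ) ≤ 2 * (scalesAt A B D).P4 →
      thinVarianceAdd (κ D) d D twists τ
          ((D : ℝ) * M * (scalesAt A B D).P * (scalesAt A B D).t0) M
        ≤ C * ((D : ℝ) * M * (scalesAt A B D).P * (scalesAt A B D).t0) ^ 2
            * (M0 (scalesAt A B D) D c / M) * Real.log D ^ C'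

/-- **`ThinBDH A B κ` — the card's First lemma / residue of the prime discharge** (the ideator's
`LsKnifeEllIdea1.ThinBDH`, same binders): `∃ c > 0, ThinBDHAt A B c κ`. OPEN; asserted by no one.
[cite: Zhang2022LandauSiegel, §14 (14.6)–(14.8) p.79; §15 (15.1)–(15.2)] -/
def ThinBDH (A B : ℝ) (κ : ℕ → ℕ → ℂ) : Prop :=
  ∃ c : ℝ, 0 < c ∧ ThinBDHAt A B c κ

/-! ## Part C — the card's crux K2 (the BRIDGE) as a `Prop`, and its trivial instance from the priced ∀κ form -/

/-- **E-016′'s conclusion for ONE coefficient family `κ : D ↦ κ_D`** (no ⟨A⟩ guard: the bridge is harmonic analysis):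
for every implied constant `Bτ` there are `c′ > 0`, `C` with, for all large `D` and every real primitive `χ (mod D)`,
(14.1) for `κ_D` and (14.2) for `𝐚*` ⇒ faithful majorant `≤ C·P²·D^{1/2−c′}`.
[cite: Zhang2022LandauSiegel, §14 (14.1)–(14.2) p.76, (14.8) p.79] -/
def FaithfulBoundFor (A B : ℝ) (κ : ℕ → ℕ → ℂ) : Prop :=
  ∀ Bτ : ℝ, ∃ c' : ℝ, 0 < c' ∧ ∃ C : ℝ, ForAllLarge fun D _ χ =>
    ∀ as : ℕ → ℂ, Eq141 Bτ (κ D) → Eq142At (scalesAt A B D) Bτ as →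
      rhs148FaithfulAt χ (scalesAt A B D) (κ D) (largeConductorRange (scalesAt A B D) D)
        ≤ C * (scalesAt A B D).P ^ 2 * (D : ℝ) ^ (1 / 2 - c')

/-- **The card's crux K2 — the BRIDGE (OPEN; the ideator calls it provable bookkeeping: Cauchy–Schwarz over `p ∼ P`,
injectivity of `p ↦ p̄ (mod Dk)` for `Dk > 2P`, Plancherel on `ℤ/Dk`, CRT, seam multiplicity `D^{c}t₀`, the `d`-sum,
Mellin inflation `ℒ^{119}`, the `(m,D) > 1` moduli):** for every coefficient family `κ` and every `c > 0` with
`B ∈ (¼ + c, ½)`, `ThinBDHAt A B c κ` implies E-016′'s conclusion for `κ`. Nothing here proves it. ERRATUM (v3, critic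
ls-knife-crit-2 g4 F-ℓ13 03:16:36Z / 03:21:16Z; custodian ls-theory g2 03:22:06Z (3)): AS TYPED this bridge asks the thin
family of `ThinBDHAt` to control the strictly larger `largeConductorRange` (conductors `p·D·r″`, `p ∣ D`, included there,
absent from the hypothesis) — presumably FALSE as typed for `B < ½` (critic's desk argument via BN-ℓ8; under GRH on the whole
window); SUPERSEDED as the bridge of record by `ThinBDHBridgeAll` (`KnifeEdgeEllThinBDHAll`). Kept because landed and cited.
[cite: Zhang2022LandauSiegel, §14 (14.5)–(14.8) pp.78–79; §15 (15.1)–(15.2)] -/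
def ThinBDHBridge (A B : ℝ) : Prop :=
  ∀ κ : ℕ → ℕ → ℂ, ∀ c : ℝ, 0 < c → 1 / 4 + c < B → B < 1 / 2 → ThinBDHAt A B c κ → FaithfulBoundFor A B κ

/-- **Bookkeeping: the priced `∀κ` form E-016′ gives the conclusion for EVERY family** (so what the bridge adds is exactly
the passage from a hypothesis ON `κ` to the bound for THAT `κ`; by the card's P2/BN-ℓ8 the `∀κ` form is the large-sieve
barrier itself). [cite: Zhang2022LandauSiegel, §14 (14.8) p.79] -/
theorem faithfulBoundFor_all_of_uncond {A B : ℝ} (h : Eq148DUniformFaithfulUncond A B) (κ : ℕ → ℕ → ℂ) :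
    FaithfulBoundFor A B κ := by
  intro Bτ
  obtain ⟨c, hc, C, D₀, hD₀⟩ := h Bτ
  exact ⟨c, hc, C, D₀, fun D _ χ hD hq hp as h1 h2 => hD₀ D χ hD hq hp (κ D) as h1 h2⟩

/-- Under a TRUE bridge, the card's thesis `ThinBDHAt A B c κ*` at a family `κ*` on the window `B ∈ (¼ + c, ½)` discharges
E-016′'s conclusion for `κ*` (the one-line composition the route's assembly would use). [cite: Zhang2022LandauSiegel, §14 (14.8) p.79] -/
theorem faithfulBoundFor_of_bridge {A B c : ℝ} {κ : ℕ → ℕ → ℂ} (hbr : ThinBDHBridge A B) (hc : 0 < c)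
    (hB : 1 / 4 + c < B) (hB' : B < 1 / 2) (hκ : ThinBDHAt A B c κ) : FaithfulBoundFor A B κ :=
  hbr κ c hc hB hB' hκ

/-! ## Part D — non-vacuity bookkeeping at the scales `scalesAt A B D` (the card's cheapest falsifier (b)) -/

/-- `M₀ > 0` at every scale record with `t₀ ≠ 0` and `D ≥ 1`. [cite: Zhang2022LandauSiegel, §14 (14.8) p.79] -/
theorem M0_pos (S : Scales) {D : ℕ} (hD : 0 < D) (ht : S.t0 ≠ 0) (c : ℝ) : 0 < M0 S D c := by
  unfold M0
  refine mul_pos (mul_pos (Real.exp_pos _) (Real.rpow_pos_of_pos (Nat.cast_pos.mpr hD) _)) ?_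
  exact inv_pos.mpr (pow_pos (lt_of_le_of_ne (sq_nonneg _) (Ne.symm (pow_ne_zero 2 ht))) 1 |>.trans_eq (pow_one _))

/-- **The exact ratio `M₀/(2P₄) = D^{2B−1−2c}/(2t₀³)`** at `scalesAt A B D` (`D ≥ 1`): the large-sieve size `N²` is beaten by
at most this factor at the top of the modulus range. [cite: Zhang2022LandauSiegel, §14 (14.8) p.79] -/
theorem M0_div_two_mul_P4 (A B c : ℝ) {D : ℕ} (hD : 0 < D) :
    M0 (scalesAt A B D) D c / (2 * (scalesAt A B D).P4) =
      (D : ℝ) ^ (2 * B - 1 - 2 * c) / (2 * (scalesAt A B D).t0 ^ 3) := by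
  have hDr : (0 : ℝ) < D := Nat.cast_pos.mpr hD
  have hP : (scalesAt A B D).P = (D : ℝ) ^ A := scalesAt_P_eq_rpow A B hD.ne'
  have hT : (scalesAt A B D).T = (D : ℝ) ^ B := by
    show Real.exp (B * Real.log D) = (D : ℝ) ^ B
    rw [Real.rpow_def_of_pos hDr, mul_comm]
  simp only [Scales.P4, M0, hP, hT]
  have h1 : ((D : ℝ) ^ B) ^ 2 = (D : ℝ) ^ (2 * B) := by
    rw [← Real.rpow_natCast, ← Real.rpow_mul hDr.le]; norm_num; ring_nf
  have h2 : (D : ℝ) ^ (2 * B - 1 - 2 * c) = (D : ℝ) ^ (2 * B) * (D : ℝ) ^ (-1 - 2 * c) := by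
    rw [← Real.rpow_add hDr]; ring_nf
  rw [h1, h2]
  have hA : (0 : ℝ) < (D : ℝ) ^ A := Real.rpow_pos_of_pos hDr A
  have h2B : (0 : ℝ) < (D : ℝ) ^ (2 * B) := Real.rpow_pos_of_pos hDr _
  field_simp

/-- **Non-vacuity of the modulus range of `ThinBDHAt`**: for `B ≤ ½ + c` and `D ≥ 3` (so `log D ≥ 1`, `t₀ ≥ 1`),
`M₀ ≤ 2P₄` at `scalesAt A B D` — the range `[M₀, 2P₄]` is nonempty on the whole B-ell window `B < ½`.
[cite: Zhang2022LandauSiegel, §14 (14.8) p.79] -/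
theorem M0_le_two_mul_P4 (A B c : ℝ) {D : ℕ} (hD : 3 ≤ D) (hB : B ≤ 1 / 2 + c) :
    M0 (scalesAt A B D) D c ≤ 2 * (scalesAt A B D).P4 := by
  have hD0 : 0 < D := by omega
  have hDr : (0 : ℝ) < D := Nat.cast_pos.mpr hD0
  have hlog : 1 ≤ Real.log D := by
    rw [← Real.log_exp 1]
    refine Real.log_le_log (Real.exp_pos 1) ?_
    have h3 : (3 : ℝ) ≤ D := by exact_mod_cast hD
    exact (Real.exp_one_lt_d9.le.trans (by norm_num)).trans h3
  have ht : 1 ≤ (scalesAt A B D).t0 := by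
    show 1 ≤ Real.log D ^ 519
    exact one_le_pow₀ hlog
  have ht0 : 0 < (scalesAt A B D).t0 := one_pos.trans_le ht
  have hP4 : 0 < (scalesAt A B D).P4 := by
    unfold Scales.P4 Scales.P Scales.T
    positivity
  rw [← div_le_one (by positivity), M0_div_two_mul_P4 A B c hD0, div_le_one (by positivity)]
  have hexp : (D : ℝ) ^ (2 * B - 1 - 2 * c) ≤ 1 :=
    Real.rpow_le_one_of_one_le_of_nonpos (by exact_mod_cast (show 1 ≤ D by omega)) (by linarith)
  have ht3 : 1 ≤ (scalesAt A B D).t0 ^ 3 := one_le_pow₀ ht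
  linarith

/-! ## Part E (v2 append) — the card's one-line size check: the generic ℓ-side size meets the tolerance iff `B > ¼ + c/2` -/

/-- **Generic size vs tolerance (the card's «Fastest refutation», first check), made eventual and kernel:** at the
scales `scalesAt A B D` (`P = D^A`, `T = D^B`, `t₀ = 𝓛⁵¹⁹`), if `B > ¼ + c/2` then for all large `D` the generic
ℓ-side size `2·P²·D^{1−2B}·t₀^{3/2}` is at most the tolerance `P²·D^{1/2−c}` (the polylog `2t₀^{3/2} = 2𝓛^{778.5}`
is absorbed by `D^{2B−½−c}`, `2B − ½ − c > 0`). Pure bookkeeping; nothing about `ThinBDH` itself.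
[cite: Zhang2022LandauSiegel, §14 (14.5)–(14.8) pp.78–79] -/
theorem genericSize_le_tolerance_eventually (A : ℝ) {B c : ℝ} (hB : 1 / 4 + c / 2 < B) :
    ∀ᶠ D : ℕ in Filter.atTop,
      2 * (scalesAt A B D).P ^ 2 * (D : ℝ) ^ (1 - 2 * B) * (scalesAt A B D).t0 ^ (3 / 2 : ℝ)
        ≤ (scalesAt A B D).P ^ 2 * (D : ℝ) ^ (1 / 2 - c) := by
  have hε0 : 0 < 2 * B - 1 / 2 - c := by linarith
  -- `(log x)^{1557/2} = o(x^{2B − ½ − c})`, hence eventually `2 (log x)^{1557/2} ≤ x^{2B − ½ − c}`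
  have hlo := isLittleO_log_rpow_rpow_atTop (1557 / 2 : ℝ) hε0
  have hev : ∀ᶠ x : ℝ in Filter.atTop,
      2 * Real.log x ^ (1557 / 2 : ℝ) ≤ x ^ (2 * B - 1 / 2 - c) := by
    filter_upwards [hlo.def (by norm_num : (0:ℝ) < 1 / 2), Filter.eventually_ge_atTop (1:ℝ)] with x hx hx1
    have hlog : 0 ≤ Real.log x := Real.log_nonneg hx1
    rw [Real.norm_of_nonneg (Real.rpow_nonneg hlog _),
      Real.norm_of_nonneg (Real.rpow_nonneg (zero_le_one.trans hx1) _)] at hx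
    linarith
  filter_upwards [tendsto_natCast_atTop_atTop.eventually hev, Filter.eventually_ge_atTop 3] with D hD hD3
  have hD0 : 0 < D := by omega
  have hDr : (0 : ℝ) < D := Nat.cast_pos.mpr hD0
  have hlog : 0 ≤ Real.log D := Real.log_nonneg (by exact_mod_cast (show 1 ≤ D by omega))
  -- `t₀^{3/2} = (log D)^{1557/2}`
  have ht : (scalesAt A B D).t0 ^ (3 / 2 : ℝ) = Real.log D ^ (1557 / 2 : ℝ) := by
    show (Real.log D ^ 519) ^ (3 / 2 : ℝ) = Real.log D ^ (1557 / 2 : ℝ)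
    rw [← Real.rpow_natCast, ← Real.rpow_mul hlog]
    norm_num
  -- `D^{1/2−c} = D^{1−2B}·D^{2B−½−c}`
  have hsplit : (D : ℝ) ^ (1 / 2 - c) = (D : ℝ) ^ (1 - 2 * B) * (D : ℝ) ^ (2 * B - 1 / 2 - c) := by
    rw [← Real.rpow_add hDr]; ring_nf
  rw [ht, hsplit]
  have hPD : 0 ≤ (scalesAt A B D).P ^ 2 * (D : ℝ) ^ (1 - 2 * B) :=
    mul_nonneg (sq_nonneg _) (Real.rpow_nonneg hDr.le _)
  calc 2 * (scalesAt A B D).P ^ 2 * (D : ℝ) ^ (1 - 2 * B) * Real.log D ^ (1557 / 2 : ℝ)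
      = (scalesAt A B D).P ^ 2 * (D : ℝ) ^ (1 - 2 * B) * (2 * Real.log D ^ (1557 / 2 : ℝ)) := by ring
    _ ≤ (scalesAt A B D).P ^ 2 * (D : ℝ) ^ (1 - 2 * B) * (D : ℝ) ^ (2 * B - 1 / 2 - c) :=
        mul_le_mul_of_nonneg_left hD hPD
    _ = (scalesAt A B D).P ^ 2 * ((D : ℝ) ^ (1 - 2 * B) * (D : ℝ) ^ (2 * B - 1 / 2 - c)) := by ring

end KnifeEdgeEll.PrimeDischarge

end Literature.NumberTheory.LFunctions.Zhang2022
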